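import Literature.Analysis.Asymptotics.KaramataTauberianLaplace
import HarnessLib

/-!
# Integrals of slowly varying functions: `∫₀ᵀ f ∼ A T L(T)` when `f ∼ A L` (monotone `L`)

Topic `Literature/Analysis/Asymptotics`; companion (theorems only) to `KaramataTauberianLaplace.lean`
(`IsSlowlyVarying`). The elementary "Abelian"/Cesàro direction of Karamata's theorem on integrals
of regularly varying functions, index `0`, under a monotonicity assumption that makes it a
two-line estimate: if `L` is slowly varying at `∞`, eventually positive and eventually
non-decreasing, then

* `tendsto_setIntegral_div_self` — `∫_{t₁}^T L(t) dt ∼ T L(T)` (`T → ∞`), for every `t₁` past the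
  threshold: `∫_{t₁}^T L ≤ (T - t₁) L(T)` from above, `∫_{θT}^T L ≥ (1-θ) T L(θT)` and
  `L(θT)/L(T) → 1` from below;
* `tendsto_setIntegral_div_of_tendsto_div` — consequently, for `f` integrable on each `(0,T]` with
  `f(t)/L(t) → A`, `(∫₀ᵀ f)/(T L(T)) → A` (write `f = A L + r`, `|r| ≤ δ L` eventually; the initial
  segment is constant while `T L(T) → ∞`).

(Feller, vol. II, VIII.9, Theorem 1 treats general regularly varying integrands without
monotonicity, via the uniform convergence theorem; only this easy case is needed for
`Literature.Barriers.CriticalPhenomena.CTWSAW.BBS2015_cesaro_corrected_of_pointwise`, where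
`L = (log ·)^{1/4}`.)

## References

* W. Feller, *An Introduction to Probability Theory and Its Applications* II, 2nd ed. 1971,
  VIII.8–9 (regular variation; integrals of regularly varying functions) and XIII.5 (5.14).
  [cite: Feller1971]
-/

noncomputable section

open MeasureTheory Filter Set
open scoped Topology

namespace Literature.Analysis.Asymptotics

variable {L f : ℝ → ℝ} {A t₀ : ℝ}

/-- A function non-decreasing on `[t₀, ∞)` is integrable on every `(a, b]` with `t₀ ≤ a`. [folklore] -/
theorem integrableOn_Ioc_of_monotoneOn (hmono : MonotoneOn L (Ici t₀)) {a b : ℝ} (ha : t₀ ≤ a) :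
    IntegrableOn L (Ioc a b) := by
  have h : MonotoneOn L (Icc a b) := hmono.mono fun x hx => ha.trans hx.1
  exact (h.integrableOn_isCompact isCompact_Icc).mono_set Ioc_subset_Icc_self

/-- Upper bound: `∫_{a}^{T} L ≤ (T - a) L(T)` for `L` non-decreasing on `[t₀, ∞)`, `t₀ ≤ a ≤ T`.
[folklore] -/
theorem setIntegral_le_sub_mul (hmono : MonotoneOn L (Ici t₀)) {a T : ℝ} (ha : t₀ ≤ a)
    (haT : a ≤ T) : ∫ t in Ioc a T, L t ≤ (T - a) * L T := by
  have hint := integrableOn_Ioc_of_monotoneOn hmono ha (b := T)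
  calc ∫ t in Ioc a T, L t ≤ ∫ _ in Ioc a T, L T := by
        refine setIntegral_mono_on hint (integrableOn_const (by simp)) measurableSet_Ioc ?_
        intro t ht
        exact hmono (show t₀ ≤ t by exact ha.trans ht.1.le) (show t₀ ≤ T by linarith) ht.2
    _ = (T - a) * L T := by
        rw [setIntegral_const, smul_eq_mul, Real.volume_real_Ioc_of_le haT]

/-- Lower bound: `∫_{a}^{T} L ≥ (T - b) L(b)` for `L` non-decreasing on `[t₀, ∞)`, `t₀ ≤ a ≤ b ≤ T`,
provided `L ≥ 0` on `[a, b]` (we only use `L(a) ≥ 0`). [folklore] -/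
theorem sub_mul_le_setIntegral (hmono : MonotoneOn L (Ici t₀)) {a b T : ℝ} (ha : t₀ ≤ a)
    (hab : a ≤ b) (hbT : b ≤ T) (hLa : 0 ≤ L a) : (T - b) * L b ≤ ∫ t in Ioc a T, L t := by
  have hint := integrableOn_Ioc_of_monotoneOn hmono ha (b := T)
  have hsplit : ∫ t in Ioc a T, L t = (∫ t in Ioc a b, L t) + ∫ t in Ioc b T, L t := by
    rw [← setIntegral_union (Ioc_disjoint_Ioc_of_le le_rfl) measurableSet_Ioc
      (hint.mono_set (Ioc_subset_Ioc_right hbT)) (hint.mono_set (Ioc_subset_Ioc_left hab)),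
      Ioc_union_Ioc_eq_Ioc hab hbT]
  have h1 : 0 ≤ ∫ t in Ioc a b, L t := by
    refine setIntegral_nonneg measurableSet_Ioc fun t ht => hLa.trans ?_
    exact hmono (show t₀ ≤ a from ha) (show t₀ ≤ t by exact ha.trans ht.1.le) ht.1.le
  have h2 : (T - b) * L b ≤ ∫ t in Ioc b T, L t := by
    calc (T - b) * L b = ∫ _ in Ioc b T, L b := by
          rw [setIntegral_const, smul_eq_mul, Real.volume_real_Ioc_of_le hbT]
      _ ≤ ∫ t in Ioc b T, L t := by
          refine setIntegral_mono_on (integrableOn_const (by simp))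
            (hint.mono_set (Ioc_subset_Ioc_left hab)) measurableSet_Ioc fun t ht => ?_
          exact hmono (show t₀ ≤ b by linarith) (show t₀ ≤ t by linarith [ht.1]) ht.1.le
  linarith

/-- **`∫_{t₁}^T L ∼ T L(T)`** for `L` slowly varying, eventually positive and non-decreasing on
`[t₀, ∞)`, and any `t₁ ≥ t₀` with `L(t₁) > 0`. [cite: Feller1971, VIII.9 Theorem 1 (case of a monotone slowly varying integrand)] -/
theorem tendsto_setIntegral_div_self (hL : IsSlowlyVarying L) (hmono : MonotoneOn L (Ici t₀))
    {t₁ : ℝ} (ht₁ : t₀ ≤ t₁) (ht₁0 : 0 ≤ t₁) (hLt₁ : 0 < L t₁) :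
    Tendsto (fun T : ℝ => (∫ t in Ioc t₁ T, L t) / (T * L T)) atTop (𝓝 1) := by
  have hLpos : ∀ t, t₁ ≤ t → 0 < L t := fun t ht =>
    hLt₁.trans_le (hmono (show t₀ ≤ t₁ from ht₁) (show t₀ ≤ t from ht₁.trans ht) ht)
  refine Metric.tendsto_nhds.mpr fun η hη => ?_
  -- lower bound parameter θ
  set θ : ℝ := min (1 / 2) (η / 2) with hθ
  have hθ0 : 0 < θ := lt_min (by norm_num) (by positivity)
  have hθ1 : θ ≤ 1 / 2 := min_le_left _ _
  have hθη : θ ≤ η / 2 := min_le_right _ _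
  have hsv := Metric.tendsto_nhds.mp (hL θ hθ0) (η / 2) (by positivity)
  filter_upwards [eventually_ge_atTop (t₁ / θ), eventually_gt_atTop t₁, eventually_gt_atTop 0, hsv]
    with T hTθ hT1 hT0 hsvT
  have hLT : 0 < L T := hLpos T hT1.le
  have hTL : 0 < T * L T := mul_pos hT0 hLT
  have hθT : t₁ ≤ θ * T := by rwa [div_le_iff₀ hθ0, mul_comm] at hTθ
  have hθTT : θ * T ≤ T := by nlinarith
  rw [Real.dist_eq, abs_lt]
  constructor
  · -- lower bound: ∫ ≥ (T - θT) L(θT) and L(θT) ≥ (1 - η/2) L(T)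
    have hlow := sub_mul_le_setIntegral hmono ht₁ hθT hθTT hLt₁.le
    rw [Real.dist_eq, abs_lt] at hsvT
    have hsv1 : 1 - η / 2 < L (θ * T) / L T := by linarith [hsvT.1]
    have hLθ : (1 - η / 2) * L T < L (θ * T) := by rwa [lt_div_iff₀ hLT] at hsv1
    have h3 : (1 - θ) * ((1 - η / 2) * (T * L T)) ≤ ∫ t in Ioc t₁ T, L t := by
      have : (T - θ * T) * L (θ * T) = (1 - θ) * (T * L (θ * T)) := by ring
      rw [this] at hlow
      have h1θ : 0 ≤ 1 - θ := by linarith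
      nlinarith [mul_le_mul_of_nonneg_left hLθ.le hT0.le]
    have h4 : (1 - θ) * (1 - η / 2) - 1 ≤ (∫ t in Ioc t₁ T, L t) / (T * L T) - 1 := by
      rw [le_sub_iff_add_le, sub_add_cancel, le_div_iff₀ hTL]
      have : (1 - θ) * (1 - η / 2) * (T * L T) = (1 - θ) * ((1 - η / 2) * (T * L T)) := by ring
      rw [this]
      exact h3
    have h5 : -η < (1 - θ) * (1 - η / 2) - 1 := by nlinarith [mul_pos hθ0 hη]
    linarith
  · -- upper bound: ∫ ≤ (T - t₁) L(T) ≤ T L(T)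
    have hup := setIntegral_le_sub_mul hmono ht₁ hT1.le
    have : (∫ t in Ioc t₁ T, L t) / (T * L T) ≤ 1 := by
      rw [div_le_one hTL]
      nlinarith [mul_nonneg ht₁0 hLT.le]
    linarith

/-- **`∫₀ᵀ f ∼ A T L(T)` when `f ∼ A L`**: for `L` slowly varying and non-decreasing on some
`[t₀, ∞)` with `L → ` eventually positive, and `f` integrable on each `(0, T]` with `f(t)/L(t) → A`
as `t → ∞`, one has `(∫_{(0,T]} f)/(T L(T)) → A`. [cite: Feller1971, VIII.9 Theorem 1 (case of a monotone slowly varying comparison function)] -/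
theorem tendsto_setIntegral_div_of_tendsto_div (hL : IsSlowlyVarying L) (hmono : MonotoneOn L (Ici t₀))
    (hLpos : ∀ᶠ t in atTop, 0 < L t) (hf : ∀ T, IntegrableOn f (Ioc 0 T))
    (hfL : Tendsto (fun t => f t / L t) atTop (𝓝 A)) :
    Tendsto (fun T : ℝ => (∫ t in Ioc 0 T, f t) / (T * L T)) atTop (𝓝 A) := by
  refine Metric.tendsto_nhds.mpr fun η hη => ?_
  -- error level δ with 3δ(|A| + 2) ≤ η, roughly
  set δ : ℝ := min (1 / 2) (η / (4 * (|A| + 2))) with hδ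
  have hA2 : 0 < |A| + 2 := by positivity
  have hδ0 : 0 < δ := lt_min (by norm_num) (by positivity)
  have hδ1 : δ ≤ 1 / 2 := min_le_left _ _
  have hδη : δ * (4 * (|A| + 2)) ≤ η := by
    have h : δ ≤ η / (4 * (|A| + 2)) := min_le_right _ _
    rwa [le_div_iff₀ (by positivity)] at h
  -- threshold t₁: L monotone, positive, |f/L - A| < δ beyond t₁
  obtain ⟨t₁, ht₁⟩ : ∃ t₁, (max t₀ 0 ≤ t₁) ∧ ∀ t, t₁ ≤ t → 0 < L t ∧ |f t / L t - A| < δ := by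
    have hev : ∀ᶠ t in atTop, 0 < L t ∧ |f t / L t - A| < δ := by
      filter_upwards [hLpos, Metric.tendsto_nhds.mp hfL δ hδ0] with t h1 h2
      exact ⟨h1, by rwa [Real.dist_eq] at h2⟩
    obtain ⟨t₂, ht₂⟩ := (hev.and (eventually_ge_atTop (max t₀ 0))).exists_forall_of_atTop
    exact ⟨t₂, (ht₂ t₂ le_rfl).2, fun t ht => (ht₂ t ht).1⟩
  obtain ⟨ht₁m, ht₁⟩ := ht₁
  have ht₀t₁ : t₀ ≤ t₁ := (le_max_left _ _).trans ht₁m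
  have ht₁0 : 0 ≤ t₁ := (le_max_right _ _).trans ht₁m
  have hLt₁ : 0 < L t₁ := (ht₁ t₁ le_rfl).1
  -- the pieces
  have hI := tendsto_setIntegral_div_self hL hmono ht₀t₁ ht₁0 hLt₁
  have hTL : Tendsto (fun T : ℝ => T * L T) atTop atTop := by
    refine tendsto_atTop_mono' atTop ?_ (tendsto_id.atTop_mul_const hLt₁)
    filter_upwards [eventually_ge_atTop t₁, eventually_ge_atTop 0] with T hT hT0
    exact mul_le_mul_of_nonneg_left (hmono (show t₀ ≤ t₁ from ht₀t₁)
      (show t₀ ≤ T from ht₀t₁.trans hT) hT) hT0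
  have hC : Tendsto (fun T : ℝ => (∫ t in Ioc 0 t₁, f t) / (T * L T)) atTop (𝓝 0) :=
    tendsto_const_nhds.div_atTop hTL
  filter_upwards [eventually_gt_atTop t₁, eventually_gt_atTop 0, Metric.tendsto_nhds.mp hI δ hδ0,
    Metric.tendsto_nhds.mp hC δ hδ0] with T hT1 hT0 hIT hCT
  rw [Real.dist_eq] at hIT hCT ⊢
  rw [sub_zero] at hCT
  have hLT : 0 < L T := (ht₁ T hT1.le).1
  have hTLpos : 0 < T * L T := mul_pos hT0 hLT
  have hT0' : T ≠ 0 := hT0.ne'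
  have hLT' : L T ≠ 0 := hLT.ne'
  -- split the integral at t₁
  have hsplit : ∫ t in Ioc 0 T, f t = (∫ t in Ioc 0 t₁, f t) + ∫ t in Ioc t₁ T, f t := by
    rw [← setIntegral_union (Ioc_disjoint_Ioc_of_le le_rfl) measurableSet_Ioc
      ((hf T).mono_set (Ioc_subset_Ioc_right hT1.le)) ((hf T).mono_set (Ioc_subset_Ioc_left ht₁0)),
      Ioc_union_Ioc_eq_Ioc ht₁0 hT1.le]
  -- on (t₁, T]: (A - δ) L ≤ f ≤ (A + δ) L, i.e. |f - A L| ≤ δ L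
  have hLint : IntegrableOn L (Ioc t₁ T) := integrableOn_Ioc_of_monotoneOn hmono ht₀t₁
  have hfint : IntegrableOn f (Ioc t₁ T) := (hf T).mono_set (Ioc_subset_Ioc_left ht₁0)
  have hbound : ∀ t ∈ Ioc t₁ T, |f t - A * L t| ≤ δ * L t := by
    intro t ht
    obtain ⟨hLt, hft⟩ := ht₁ t ht.1.le
    have hLt' : L t ≠ 0 := hLt.ne'
    have : f t - A * L t = (f t / L t - A) * L t := by field_simp
    rw [this, abs_mul, abs_of_pos hLt]
    exact mul_le_mul_of_nonneg_right hft.le hLt.le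
  have hdiff : |(∫ t in Ioc t₁ T, f t) - A * ∫ t in Ioc t₁ T, L t| ≤ δ * ∫ t in Ioc t₁ T, L t := by
    rw [← integral_const_mul, ← integral_sub hfint (hLint.const_mul A), ← integral_const_mul]
    refine (abs_integral_le_integral_abs).trans ?_
    refine setIntegral_mono_on ?_ (hLint.const_mul δ) measurableSet_Ioc hbound
    exact (hfint.sub (hLint.const_mul A)).abs
  -- ∫_{t₁}^T L ≤ T L(T)
  have hIup : ∫ t in Ioc t₁ T, L t ≤ T * L T := by
    have := setIntegral_le_sub_mul hmono ht₀t₁ hT1.le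
    nlinarith
  have hInn : 0 ≤ ∫ t in Ioc t₁ T, L t :=
    setIntegral_nonneg measurableSet_Ioc fun t ht => (ht₁ t ht.1.le).1.le
  -- assemble: |∫₀ᵀ f/(TL) - A| ≤ |C/(TL)| + |A| |∫L/(TL) - 1| + δ ∫L/(TL)
  have hratio : (∫ t in Ioc 0 T, f t) / (T * L T) - A =
      (∫ t in Ioc 0 t₁, f t) / (T * L T) +
        (((∫ t in Ioc t₁ T, f t) - A * ∫ t in Ioc t₁ T, L t) / (T * L T)) +
        A * ((∫ t in Ioc t₁ T, L t) / (T * L T) - 1) := by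
    rw [hsplit]
    field_simp
    ring
  rw [hratio]
  have h1 : |((∫ t in Ioc t₁ T, f t) - A * ∫ t in Ioc t₁ T, L t) / (T * L T)| ≤ δ := by
    rw [abs_div, abs_of_pos hTLpos, div_le_iff₀ hTLpos]
    exact hdiff.trans (mul_le_mul_of_nonneg_left hIup hδ0.le)
  have h2 : |A * ((∫ t in Ioc t₁ T, L t) / (T * L T) - 1)| ≤ |A| * δ := by
    rw [abs_mul]
    exact mul_le_mul_of_nonneg_left hIT.le (abs_nonneg A)
  calc |(∫ t in Ioc 0 t₁, f t) / (T * L T) +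
        ((∫ t in Ioc t₁ T, f t) - A * ∫ t in Ioc t₁ T, L t) / (T * L T) +
        A * ((∫ t in Ioc t₁ T, L t) / (T * L T) - 1)|
      ≤ |(∫ t in Ioc 0 t₁, f t) / (T * L T)| +
          |((∫ t in Ioc t₁ T, f t) - A * ∫ t in Ioc t₁ T, L t) / (T * L T)| +
          |A * ((∫ t in Ioc t₁ T, L t) / (T * L T) - 1)| := abs_add_three _ _ _
    _ ≤ δ + δ + |A| * δ := by linarith [hCT.le]
    _ < η := by nlinarith [abs_nonneg A, hδη, hδ0, hη]

end Literature.Analysis.Asymptotics
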